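import Literature.AlgebraicGeometry.Resolution.AlterationsSemiStableCodimTwoBlowupNodalFibresClosedPoint
import Literature.AlgebraicGeometry.Resolution.AlterationsSemiStableCodimTwoBlowupNodalFibres
import Literature.AlgebraicGeometry.Resolution.SemiStablePairFieldBaseChange
import Literature.AlgebraicGeometry.Resolution.AlterationsSemiStableCodimTwoBlowupCentre
import HarnessLib

/-!
# De Jong 1996, 3.4, Claim (ii), clause (b) — the discharge
# `DeJong1996SemiStableCodimTwoBlowupNodalFibres_holds`, and 4.23–4.28 in full

Topic: `Literature/AlgebraicGeometry/Resolution`. Discharge of the named fact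
`DeJong1996SemiStableCodimTwoBlowupNodalFibres` of `AlterationsSemiStableCodimTwoBlowupNodalFibres.lean`
(de Jong 1996, 3.4, Claim (ii): for the curve `f : X → Y` of a pair in Situation 4.23 over an
algebraically closed field `k`, a codimension-`2` component `T = cl{x}` of `Sing(X)` and a blowing
up `π : X' → X` of `T`, the closed points over `T` of the GEOMETRIC fibres of `π ≫ f` are
nonsingular points of curves or ordinary double points), the last open input of de Jong's 4.24
(`DeJong1996SemiStablePairNormalForm`) and hence of 4.23–4.28 (`DeJong1996SemiStablePairResolution`).

The proof reads a geometric fibre over `s̄ : Spec K → Y` as a CLOSED fibre after base change of the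
whole pair to `K` (`K` a `k`-algebra through `s̄`; 2.21: "for every algebraically closed field `K`
and every `s̄ : Spec K → S` …"):

* the base change `X_K = X ×_Y Y_K → Y_K = Y ×_k Spec K` is again a pair in Situation 4.23
  (`DeJong1996.SemiStablePair.baseChange_field`, `SemiStablePairFieldBaseChange.lean`), `s̄` becomes
  a `K`-rational (closed) point `y_K` of `Y_K` with `κ(y_K) = K`, and
  `X' ×_Y Spec K ≅ (X' ×_X X_K)_{y_K}` (pasting of fibre products);
* `X' ×_X X_K → X_K` is the blowing up of `X_K` in the pulled-back ideal sheaf (GW 13.91 (2),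
  `IsBlowup.pullback_snd_of_flat`), which is the ideal sheaf of `T_K = cl{x_K}`, the preimage of
  `T`, `x_K` again a codimension-`≤ 2` singular point (`exists_comap_vanishingIdeal_closure_eq`,
  `mem_singularLocusCodimLE_of_generic_fibre`; the pieces `T ×_k K`, `κ(x) ×_k K` are integral by
  geometric integrality over the algebraically closed `k`, GW 5.56);
* at a closed point of a closed fibre the statement is
  `DeJong1996.SemiStablePair.isRegularLocalRing_or_isOrdinaryDoublePoint_fiber_blowup`
  (`AlterationsSemiStableCodimTwoBlowupNodalFibresClosedPoint.lean`: the printed chart computation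
  of 3.4 on the completed local rings, `FormalNodeRingBlowupFibreCharts.lean`).

With the fact discharged, the cascade prepared in `AlterationsSemiStableCodimTwoBlowupNodalFibres.lean`,
`AlterationsSemiStableCodimTwoBlowupFibres.lean`, `AlterationsSemiStableCodimTwoBlowupCentre.lean` and
`AlterationsSemiStableCodimTwoBlowupExceptionalConnectedHolds.lean` yields THEOREMS:
`DeJong1996SemiStableCodimTwoBlowupFlatNodal_holds`, `DeJong1996SemiStableCodimTwoBlowupCentre_holds`,
`DeJong1996SemiStableCodimTwoBlowupCore_holds`, `DeJong1996SemiStableCodimTwoModification_holds`,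
`DeJong1996Lemma32_holds` (de Jong 1996, Lemma 3.2), `DeJong1996SemiStableCodimThree_holds`,
`DeJong1996SemiStablePairNormalForm_holds` (4.24) and `DeJong1996SemiStablePairResolution_holds`
(4.23–4.28). Everything is PROVED; no definition, no named fact.

## Sources

* A. J. de Jong, *Smoothness, semi-stability and alterations*, Publ. Math. IHÉS 83 (1996) 51–93:
  2.21, 3.2–3.5 (pp. 61–65), 4.23–4.28 (pp. 75–76). [DeJong1996]
* U. Görtz, T. Wedhorn, *Algebraic Geometry I*, 2nd ed. (2020), Prop. 13.91 (2), Prop. 5.51/Cor. 5.56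
  (via `BlowupsFlatBaseChange.lean`, `Motives/GeometricallyIntegralAlgClosed.lean`). [GortzWedhorn2020]
-/

noncomputable section

open CategoryTheory CategoryTheory.Limits AlgebraicGeometry TopologicalSpace Topology IsLocalRing

namespace Literature.AlgebraicGeometry.Resolution

universe u

open Scheme.IdealSheafData

/-! ## Integral pieces of the base change to `K` -/

/-- For an integral `W → X` over the algebraically closed `k`, the base change
`W ×_X X_K = W ×_k Spec K` (pasting) is integral (geometric integrality over an algebraically
closed field). [cite: GortzWedhorn2020, Prop. 5.51 and Cor. 5.56] -/
private theorem isIntegral_pullback_fst_fst {k : Type u} [Field k] [IsAlgClosed k]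
    {X Y : Scheme.{u}} (f : X ⟶ Y) (g : Y ⟶ Spec (.of k)) (K : Type u) [Field K] [Algebra k K]
    {W : Scheme.{u}} (h : W ⟶ X) [IsIntegral W] :
    IsIntegral (pullback (pullback.fst f (pullback.fst g (specOfAlgebra k K))) h) := by
  haveI : GeometricallyIntegral ((h ≫ f) ≫ g) :=
    Literature.AlgebraicGeometry.Motives.geometricallyIntegral_of_isAlgClosed _
  haveI : IsIntegral (pullback ((h ≫ f) ≫ g) (specOfAlgebra k K)) :=
    GeometricallyIntegral.isIntegral_of_subsingleton (pullback.snd ((h ≫ f) ≫ g) (specOfAlgebra k K))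
  let e : pullback h (pullback.fst f (pullback.fst g (specOfAlgebra k K))) ≅
      pullback ((h ≫ f) ≫ g) (specOfAlgebra k K) :=
    (pullbackRightPullbackFstIso f (pullback.fst g (specOfAlgebra k K)) h).trans
      (pullbackRightPullbackFstIso g (specOfAlgebra k K) (h ≫ f))
  haveI : IsIntegral (pullback h (pullback.fst f (pullback.fst g (specOfAlgebra k K)))) :=
    IsIntegral.of_isIso e.inv
  exact IsIntegral.of_isIso
    (pullbackSymmetry h (pullback.fst f (pullback.fst g (specOfAlgebra k K)))).hom

/-! ## The discharge -/

set_option maxHeartbeats 1600000 in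
/-- **de Jong 1996, 3.4, Claim (ii), clause (b) (`DeJong1996SemiStableCodimTwoBlowupNodalFibres`) —
PROVED.** For a geometric point `s̄ : Spec K → Y`: make `K` a `k`-algebra through `s̄ ≫ g`, base
change the pair to `K` (`DeJong1996.SemiStablePair.baseChange_field`), so that `s̄` is the closed
`K`-point `y_K` of `Y_K` with `κ(y_K) = K` and `X' ×_Y Spec K ≅ (X'_K)_{y_K}`,
`X'_K = X' ×_X X_K → X_K` being the blowing up of `T_K = cl{x_K}` (`IsBlowup.pullback_snd_of_flat`,
`exists_comap_vanishingIdeal_closure_eq`, `mem_singularLocusCodimLE_of_generic_fibre`); at a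
closed point of this closed fibre over `T_K` apply
`DeJong1996.SemiStablePair.isRegularLocalRing_or_isOrdinaryDoublePoint_fiber_blowup` (the chart
computation of 3.4, Claim (ii) on the completed local rings) and transport along the isomorphism
of fibres. [cite: DeJong1996, 3.4 Claim (ii), pp. 63–64] -/
theorem DeJong1996SemiStableCodimTwoBlowupNodalFibres_holds :
    DeJong1996SemiStableCodimTwoBlowupNodalFibres.{u} := by
  intro k _ _ X Y f g D n τ hS x hx X' π hπ K _ _ s xb hxb hT
  classical
  haveI := hS.isIntegral
  haveI := hS.locallyOfFiniteType
  haveI := hS.isNoetherian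
  haveI := hS.isNoetherian_base
  -- ### `K` as a `k`-algebra through `s̄`, and the base change of the pair to `K`
  obtain ⟨φ₀, hφ₀⟩ := Spec.map_surjective (s ≫ g)
  letI : Algebra k K := φ₀.hom.toAlgebra
  have hbc : specOfAlgebra k K = s ≫ g := by
    rw [← hφ₀]
    rfl
  have hSK := hS.baseChange_field K
  set bc : Spec (.of K) ⟶ Spec (.of k) := specOfAlgebra k K with hbcdef
  set ψ : pullback g bc ⟶ Y := pullback.fst g bc with hψdef
  haveI := hSK.isIntegral
  haveI := hSK.isNoetherian
  haveI : Flat bc := Flat.SpecMap_iff.mpr (RingHom.flat_algebraMap_iff.mpr inferInstance)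
  haveI : Flat ψ := inferInstance
  haveI : Flat (pullback.fst f ψ) := inferInstance
  haveI : Surjective bc := ⟨fun p => ⟨IsLocalRing.closedPoint K, Subsingleton.elim _ _⟩⟩
  haveI : Surjective ψ := inferInstance
  haveI : Surjective (pullback.fst f ψ) := inferInstance
  -- ### the `K`-point `y_K` of `Y_K` defined by `s̄`, closed, with residue field `K`
  let sK : Spec (.of K) ⟶ pullback g bc :=
    pullback.lift s (𝟙 _) (by rw [Category.id_comp, hbc])
  have hsKψ : sK ≫ ψ = s := pullback.lift_fst _ _ _
  have hsKg : sK ≫ pullback.snd g bc = 𝟙 _ := pullback.lift_snd _ _ _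
  set yK : ↥(pullback g bc) := sK (IsLocalRing.closedPoint K) with hyKdef
  have hyK : IsClosed ({yK} : Set ↥(pullback g bc)) := by
    haveI := _root_.AlgebraicGeometry.isClosedImmersion_of_comp_eq_id (pullback.snd g bc) sK hsKg
    have hr : Set.range sK = {yK} := by
      ext z
      constructor
      · rintro ⟨a, rfl⟩
        rw [Subsingleton.elim a (IsLocalRing.closedPoint K)]
        rfl
      · rintro rfl
        exact ⟨_, rfl⟩
    rw [← hr]
    exact sK.isClosedEmbedding.isClosed_range
  -- `κ(y_K) ≅ K`: the comparison map is a left inverse of `K → κ(y_K)` (through `g_K`)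
  set φ : (pullback g bc).residueField yK ⟶ CommRingCat.of K :=
    (pullback g bc).descResidueField (Scheme.stalkClosedPointTo sK) with hφdef
  have hφ : Spec.map φ ≫ (pullback g bc).fromSpecResidueField yK = sK :=
    Scheme.descResidueField_stalkClosedPointTo_fromSpecResidueField K (pullback g bc) sK
  obtain ⟨χ, hχ⟩ := Spec.map_surjective ((pullback g bc).fromSpecResidueField yK ≫ pullback.snd g bc)
  have hχφ : χ ≫ φ = 𝟙 _ := by
    apply Spec.map_injective
    rw [Spec.map_comp, Spec.map_id, hχ, ← Category.assoc, hφ, hsKg]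
  have hφbij : Function.Bijective φ.hom := by
    refine ⟨φ.hom.injective, fun a => ⟨χ.hom a, ?_⟩⟩
    have := congrArg (fun t : CommRingCat.of K ⟶ CommRingCat.of K => t.hom a) hχφ
    simpa using this
  haveI : IsIso φ := by
    refine ⟨⟨CommRingCat.ofHom (RingEquiv.ofBijective φ.hom hφbij).symm.toRingHom, ?_, ?_⟩⟩
    · ext a
      exact (RingEquiv.ofBijective φ.hom hφbij).symm_apply_apply a
    · ext a
      exact (RingEquiv.ofBijective φ.hom hφbij).apply_symm_apply a
  -- ### the blow-up base changes to the blow-up of `X_K` in `T_K = cl{x_K}`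
  have hπK₀ : IsBlowup (pullback.snd π (pullback.fst f ψ))
      ((vanishingIdeal (⟨closure {x}, isClosed_closure⟩ : Closeds X)).comap (pullback.fst f ψ)) :=
    hπ.pullback_snd_of_flat (pullback.fst f ψ)
  haveI : IsIntegral (pullback (pullback.fst f ψ)
      (vanishingIdeal (⟨closure {x}, isClosed_closure⟩ : Closeds X)).subschemeι) := by
    haveI := Literature.AlgebraicGeometry.Motives.isIntegral_subscheme_vanishingIdeal_closure x
    exact isIntegral_pullback_fst_fst f g K _
  obtain ⟨xK, hxK, hpre, hcomap⟩ := exists_comap_vanishingIdeal_closure_eq (pullback.fst f ψ) x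
  rw [hcomap] at hπK₀
  -- `x_K` is a codimension-`≤ 2` singular point of `X_K`
  haveI : IsIntegral ((pullback.fst f ψ).fiber (pullback.fst f ψ xK)) :=
    isIntegral_pullback_fst_fst f g K (X.fromSpecResidueField (pullback.fst f ψ xK))
  have hxK2 : xK ∈ Scheme.singularLocusCodimLE (pullback f ψ) 2 := by
    refine mem_singularLocusCodimLE_of_generic_fibre (pullback.fst f ψ) xK (by rw [hxK]; exact hx)
      fun w hw => ?_
    rw [specializes_iff_mem_closure, ← hpre, Set.mem_preimage, hw, hxK]
    exact subset_closure (Set.mem_singleton x)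
  -- ### `X' ×_Y Spec K ≅ (X'_K)_{y_K}`, compatibly with the projections to `X'`
  let e₁ : pullback π (pullback.fst f ψ) ≅ pullback (π ≫ f) ψ := pullbackRightPullbackFstIso f ψ π
  have he₁ : e₁.hom ≫ pullback.snd (π ≫ f) ψ =
      pullback.snd π (pullback.fst f ψ) ≫ pullback.snd f ψ :=
    pullbackRightPullbackFstIso_hom_snd f ψ π
  let Φ : pullback (π ≫ f) s ≅
      pullback (pullback.snd π (pullback.fst f ψ) ≫ pullback.snd f ψ)
        ((pullback g bc).fromSpecResidueField yK) :=
    pullback.congrHom rfl hsKψ.symm ≪≫ (pullbackLeftPullbackSndIso (π ≫ f) ψ sK).symm ≪≫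
      asIso (pullback.map (pullback.snd (π ≫ f) ψ) sK
        (pullback.snd π (pullback.fst f ψ) ≫ pullback.snd f ψ) sK e₁.inv (𝟙 _) (𝟙 _)
        (by rw [Category.comp_id, ← he₁, Iso.inv_hom_id_assoc]) (by simp)) ≪≫
      asIso (pullback.map (pullback.snd π (pullback.fst f ψ) ≫ pullback.snd f ψ) sK
        (pullback.snd π (pullback.fst f ψ) ≫ pullback.snd f ψ)
        ((pullback g bc).fromSpecResidueField yK) (𝟙 _) (Spec.map φ) (𝟙 _) (by simp)
        (by rw [Category.comp_id, hφ]))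
  have hΦ : Φ.hom ≫ pullback.fst (pullback.snd π (pullback.fst f ψ) ≫ pullback.snd f ψ)
      ((pullback g bc).fromSpecResidueField yK) ≫ pullback.fst π (pullback.fst f ψ) =
      pullback.fst (π ≫ f) s := by
    simp only [Φ, e₁, Iso.trans_hom, Iso.symm_hom, asIso_hom, pullback.congrHom_hom, Category.assoc,
      pullback.lift_fst, pullback.lift_fst_assoc, Category.comp_id,
      pullbackRightPullbackFstIso_inv_fst, pullbackLeftPullbackSndIso_inv_fst]
  -- ### the point `z` of the closed fibre `(X'_K)_{y_K}` defined by `x̄'`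
  let z : ↥((pullback.snd π (pullback.fst f ψ) ≫ pullback.snd f ψ).fiber yK) := Φ.hom xb
  have hz : IsClosed ({z} : Set ↥((pullback.snd π (pullback.fst f ψ) ≫ pullback.snd f ψ).fiber yK)) := by
    have h1 : ({z} : Set _) = Φ.hom '' {xb} := by
      rw [Set.image_singleton]
      rfl
    rw [h1]
    exact Φ.hom.isClosedEmbedding.isClosedMap _ hxb
  have hq : pullback.fst π (pullback.fst f ψ)
      (((pullback.snd π (pullback.fst f ψ) ≫ pullback.snd f ψ).fiberι yK) z) =
      pullback.fst (π ≫ f) s xb := by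
    rw [← hΦ, Scheme.Hom.comp_apply, Scheme.Hom.comp_apply]
    rfl
  have hzT : (pullback.snd π (pullback.fst f ψ))
      (((pullback.snd π (pullback.fst f ψ) ≫ pullback.snd f ψ).fiberι yK) z) ∈
        closure ({xK} : Set ↥(pullback f ψ)) := by
    rw [← hpre, Set.mem_preimage, ← Scheme.Hom.comp_apply, ← pullback.condition,
      Scheme.Hom.comp_apply, hq]
    exact hT
  -- ### 3.4, Claim (ii) over the closed point `y_K`, transported along `Φ`
  have key := hSK.isRegularLocalRing_or_isOrdinaryDoublePoint_fiber_blowup hxK2 hπK₀ hyK z hz hzT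
  let ε : ((pullback.snd π (pullback.fst f ψ) ≫ pullback.snd f ψ).fiber yK).presheaf.stalk z ≃+*
      (pullback (π ≫ f) s).presheaf.stalk xb :=
    (asIso (Φ.hom.stalkMap xb)).commRingCatIsoToRingEquiv
  rcases key with ⟨hreg, hdim⟩ | hnode
  · left
    haveI := hreg
    exact ⟨IsRegularLocalRing.of_ringEquiv ε, by rw [← ringKrullDim_eq_of_ringEquiv ε, hdim]⟩
  · exact Or.inr (hnode.of_ringEquiv ε)

/-! ## The cascade: 3.4 Claim, Lemma 3.2, 4.24 and 4.23–4.28 -/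

/-- **de Jong 1996, 3.4, Claim (ii) (`DeJong1996SemiStableCodimTwoBlowupFlatNodal`) — PROVED.**
[cite: DeJong1996, 3.4 Claim (ii), pp. 63–64] -/
theorem DeJong1996SemiStableCodimTwoBlowupFlatNodal_holds :
    DeJong1996SemiStableCodimTwoBlowupFlatNodal.{u} :=
  DeJong1996SemiStableCodimTwoBlowupFlatNodal_holds_of DeJong1996SemiStableCodimTwoBlowupNodalFibres_holds

/-- **The Claim of 3.4 on the exceptional locus (`DeJong1996SemiStableCodimTwoBlowupCentre`) —
PROVED.** [cite: DeJong1996, 3.4 Claim, pp. 63–64] -/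
theorem DeJong1996SemiStableCodimTwoBlowupCentre_holds :
    DeJong1996SemiStableCodimTwoBlowupCentre.{u} :=
  DeJong1996SemiStableCodimTwoBlowupCentre.of_fibres DeJong1996SemiStableCodimTwoBlowupFlatNodal_holds
    DeJong1996SemiStableCodimTwoBlowupExceptionalConnected_holds
    DeJong1996SemiStableCodimTwoBlowupNewComponent_holds

/-- **The Claim of 3.4 for one blow-up (`DeJong1996SemiStableCodimTwoBlowupCore`) — PROVED.**
[cite: DeJong1996, 3.4 Claim, pp. 63–64] -/
theorem DeJong1996SemiStableCodimTwoBlowupCore_holds : DeJong1996SemiStableCodimTwoBlowupCore.{u} :=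
  DeJong1996SemiStableCodimTwoBlowupCore_holds_of DeJong1996SemiStableCodimTwoBlowupNodalFibres_holds

/-- **3.4: blowing up a codimension-`2` component of `Sing(X)` (`DeJong1996SemiStableCodimTwoModification`)
— PROVED.** [cite: DeJong1996, 3.3–3.4, pp. 63–64] -/
theorem DeJong1996SemiStableCodimTwoModification_holds :
    DeJong1996SemiStableCodimTwoModification.{u} :=
  DeJong1996SemiStableCodimTwoModification.of_thickness_of_centre DeJong1996SemiStableThickness_holds
    DeJong1996SemiStableCodimTwoBlowupCentre_holds

/-- **de Jong 1996, Lemma 3.2 (`DeJong1996Lemma32`) — PROVED.** [cite: DeJong1996, Lemma 3.2, pp. 62–64] -/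
theorem DeJong1996Lemma32_holds : DeJong1996Lemma32.{u} :=
  DeJong1996Lemma32.of_flatNodal DeJong1996SemiStableCodimTwoBlowupFlatNodal_holds

/-- **4.24, first sentence (`DeJong1996SemiStableCodimThree`) — PROVED.**
[cite: DeJong1996, 3.2–3.4 and 4.24, pp. 62–64, 75] -/
theorem DeJong1996SemiStableCodimThree_holds : DeJong1996SemiStableCodimThree.{u} :=
  DeJong1996SemiStableCodimThree.of_flatNodal DeJong1996SemiStableCodimTwoBlowupFlatNodal_holds

/-- **de Jong 1996, 4.24 (`DeJong1996SemiStablePairNormalForm`): from Situation 4.23 to Situation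
4.25 — PROVED.** [cite: DeJong1996, 4.24 with 3.2–3.5, pp. 62–65, 75] -/
theorem DeJong1996SemiStablePairNormalForm_holds : DeJong1996SemiStablePairNormalForm.{u} :=
  DeJong1996SemiStablePairNormalForm_holds_of DeJong1996SemiStableCodimTwoBlowupNodalFibres_holds

/-- **de Jong 1996, 4.23–4.28 (`DeJong1996SemiStablePairResolution`): a pair in Situation 4.23 is
resolved by modifications — PROVED.** [cite: DeJong1996, 4.23–4.28, pp. 75–76] -/
theorem DeJong1996SemiStablePairResolution_holds : DeJong1996SemiStablePairResolution.{u} :=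
  DeJong1996SemiStablePairResolution_holds_of DeJong1996SemiStableCodimTwoBlowupNodalFibres_holds

end Literature.AlgebraicGeometry.Resolution

end
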